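import Summits.CriticalPhenomena.Ising3D.ExclusionSentencesAlgCore

/-!
# Exclusion sentences — family ALG (bounded-height real algebraic numbers) in kernel form
(cell `pub-ising3x`, seat recog-1)

HONEST FRAMING: lottery ticket; floor = tightest certified 3D Ising CFT bounds; no exact-solution
claim without a proof.

The frozen family `ALG` of the cell's recognition plan (`SCOPE.md` §3.1, `HOME/frozen/FAMILIES-v1.json`
sha256 `b39f709f54e6a505…`) consists of the real algebraic numbers described by an integer polynomial of
degree `d ≤ 6` and height (largest absolute coefficient) `≤ H_d`, `H = 1024/64/12/6/3/2` for
`d = 1…6`. Its members are irrational in general; the recogniser decides membership by exact root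
isolation and SCOPE §3 v1.2/v1.3 recorded ALG as "exactrec-reported, not kernel-checked". This file
makes the ALG EXCLUSION SENTENCE kernel-checkable all the same:

* `algFamily d H` — the roots of integer polynomials of degree exactly `d` and height `≤ H`
  (`mem_algFamily_of_aeval_eq_zero` connects it with Mathlib's `Polynomial ℤ`);
* `algExcluded d H a b depth fuel ex : Bool` (one `decide +kernel`; machine in
  `ExclusionSentencesAlgCore.lean`) and `algExcluded_sound`: if it returns `true`, every `x ∈ [a, b]`
  of `algFamily d H` is a root of one of the integer polynomials of the exception list `ex`
  (coefficient lists `[q₀, q₁, …]`, `evalL q x = Σ qᵢ xⁱ`). With `ex = []` the sentence reads "no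
  algebraic number of degree `d` and height `≤ H` lies in the certified interval"
  (`not_mem_algFamily_of_algExcluded`); in general `ex` is the recogniser's member list (minimal
  polynomials of the members inside and the linear polynomials `den·X − num` of the rational members —
  reducible and non-primitive multiples are discharged by exact deflation inside the checker), so the
  kernel certifies that the member list is COMPLETE: the floor's exclusion catalogue for family ALG;
* bridges from the floor's statement `IsingEnclosure W R` (typed axioms A0–A5 of
  `Literature/…/ConformalBootstrap3D/SigmaEpsilonSystem.lean`): `sigma_alg_covered_of_isingEnclosure`,
  `eps_alg_covered_of_isingEnclosure` and the contrapositive `…_not_alg_…` forms.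

The exception list for a certified interval is produced by the cell's Python twin
(`HOME/pub-ising3x-recog-1/lean/tools/alg_exceptions.py`: the same enumeration, plus an exact Sturm
classification member / near-miss of every listed polynomial) and re-decided here by the kernel — two
implementations. Kernel-checked 2D-CONTROL instances: `ExclusionSentencesControl2DAlg.lean`. Measured
kernel cost per sentence at the table heights for interval widths `≤ 10⁻³`: seconds (`d = 4`, `H = 6`
is the largest loop, 13 182 leaves, ≈ 20 s).

What is NOT here: any certificate, any 3D digit, any claim about the 3D Ising model; the statistics of
SCOPE §3.4; the transcendental families LIN/TRG (certified enclosures of `π`, `ζ(3)`, … are exactrec's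
balls; reported, never kernel-checked).
-/

namespace Summit.CriticalPhenomena.Ising3D

open Literature.MathematicalPhysics.QuantumFieldTheory.ConformalBootstrap3D

/-! ### The family and the rational-interval front end -/

/-- `algFamily d H`: the real numbers that are roots of an integer polynomial `Σ_{i ≤ d} cᵢ Xⁱ` of
degree exactly `d` (`c_d ≠ 0`) and height `≤ H` (`|cᵢ| ≤ H` for all `i`). With the cell's table
heights `H = 1024, 64, 12, 6, 3, 2` for `d = 1, …, 6` this is the frozen family `ALG` of FAMILIES-v1
graded by `κ = (d, H)` (reducible and non-primitive polynomials included — a superset, conservative). -/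
def algFamily (d H : ℕ) : Set ℝ :=
  {x | ∃ c : Fin (d + 1) → ℤ, c (Fin.last d) ≠ 0 ∧ (∀ i, |c i| ≤ H) ∧
    ∑ i, (c i : ℝ) * x ^ (i : ℕ) = 0}

/-- A root of a Mathlib polynomial `p : ℤ[X]` of degree `d` and height `≤ H` lies in `algFamily d H`. -/
theorem mem_algFamily_of_aeval_eq_zero {d H : ℕ} {x : ℝ} (p : Polynomial ℤ) (hdeg : p.natDegree = d)
    (hd : 1 ≤ d) (hH : ∀ i, |p.coeff i| ≤ H) (hroot : Polynomial.aeval x p = 0) :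
    x ∈ algFamily d H := by
  have hp : p ≠ 0 := by rintro rfl; simp at hdeg; omega
  refine ⟨fun i => p.coeff i, ?_, fun i => hH i, ?_⟩
  · simpa [Fin.val_last, ← hdeg] using Polynomial.leadingCoeff_ne_zero.mpr hp
  · rw [Polynomial.aeval_eq_sum_range, hdeg, Finset.sum_range] at hroot
    simpa [zsmul_eq_mul] using hroot

/-- `algExcluded d H a b depth fuel ex = true` certifies (`algExcluded_sound`): every `x ∈ [a, b]` of
`algFamily d H` is a root of a polynomial of the exception list `ex`. Requires `1 ≤ d` and `0 ≤ a`
(checked). Front end of `algCore` with `M = a.den · b.den`, `LO = a.num · b.den`, `HI = b.num · a.den`. -/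
def algExcluded (d H : ℕ) (a b : ℚ) (depth fuel : ℕ) (ex : List (List ℤ)) : Bool :=
  decide (1 ≤ d) && decide (0 ≤ a) &&
    algCore d H depth fuel ex (a.num * b.den) (b.num * a.den) ((a.den : ℤ) * b.den)

/-- A rational times its denominator is its numerator, in `ℝ`. -/
theorem ratCast_mul_den (q : ℚ) : (q : ℝ) * (q.den : ℝ) = (q.num : ℝ) := by
  have h := Rat.mul_den_eq_num q
  exact_mod_cast congrArg (fun r : ℚ => (r : ℝ)) h

/-- **Soundness of the ALG sentence.** If `algExcluded d H a b depth fuel ex = true` then every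
`x ∈ [a, b]` that is a root of an integer polynomial of degree `d` and height `≤ H` is a root of a listed
polynomial: `∃ q ∈ ex, evalL q x = 0`. -/
theorem algExcluded_sound {d H : ℕ} {a b : ℚ} {depth fuel : ℕ} {ex : List (List ℤ)}
    (h : algExcluded d H a b depth fuel ex = true) {x : ℝ} (hx : (a : ℝ) ≤ x ∧ x ≤ b)
    (hmem : x ∈ algFamily d H) : ∃ q ∈ ex, evalL q x = 0 := by
  simp only [algExcluded, Bool.and_eq_true, decide_eq_true_eq] at h
  obtain ⟨⟨hd, ha⟩, hcore⟩ := h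
  -- the scaled interval
  have hM : (0 : ℤ) < (a.den : ℤ) * b.den := by exact_mod_cast Nat.mul_pos a.den_pos b.den_pos
  have hLO : (0 : ℤ) ≤ a.num * b.den := mul_nonneg (Rat.num_nonneg.mpr ha) (Int.natCast_nonneg _)
  have hprod : (0 : ℝ) ≤ (a.den : ℝ) * b.den := by positivity
  have hlo : ((a.num * b.den : ℤ) : ℝ) ≤ x * (((a.den : ℤ) * b.den : ℤ) : ℝ) := by
    push_cast; rw [← ratCast_mul_den a]
    calc (a : ℝ) * a.den * b.den = a * (a.den * b.den) := by ring
      _ ≤ x * (a.den * b.den) := mul_le_mul_of_nonneg_right hx.1 hprod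
  have hhi : x * (((a.den : ℤ) * b.den : ℤ) : ℝ) ≤ ((b.num * a.den : ℤ) : ℝ) := by
    push_cast; rw [← ratCast_mul_den b]
    calc x * ((a.den : ℝ) * b.den) ≤ b * (a.den * b.den) := mul_le_mul_of_nonneg_right hx.2 hprod
      _ = (b : ℝ) * b.den * a.den := by ring
  -- normalise the coefficient vector: leading coefficient positive
  obtain ⟨c, hc, hH, hroot⟩ := hmem
  obtain ⟨k, rfl⟩ : ∃ k, d = k + 1 := ⟨d - 1, by omega⟩
  let c' : Fin (k + 2) → ℤ := fun i => if 0 < c (Fin.last (k + 1)) then c i else -c i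
  have hc' : 0 < c' (Fin.last (k + 1)) := by
    simp only [c']; split_ifs with hpos
    · exact hpos
    · omega
  have hH' : ∀ i, -(H : ℤ) ≤ c' i ∧ c' i ≤ H := fun i => by
    have := abs_le.mp (hH i)
    simp only [c']; split_ifs <;> constructor <;> linarith [this.1, this.2]
  have hroot' : evalL (List.ofFn c') x = 0 := by
    rw [evalL_ofFn]
    simp only [c']; split_ifs
    · exact hroot
    · simp only [Int.cast_neg, neg_mul, Finset.sum_neg_distrib, hroot, neg_zero]
  -- split the list as a₀ :: (mid ++ [a_d])
  have hsplit : List.ofFn c' = c' 0 :: (List.ofFn (fun i : Fin k => c' (i.castSucc).succ) ++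
      [c' (Fin.last (k + 1))]) := by
    rw [List.ofFn_succ, List.ofFn_succ', List.concat_eq_append, Fin.succ_last]
  rw [hsplit] at hroot'
  exact algCore_sound hcore hLO hM hlo hhi (by simp) ⟨hc', (hH' _).2⟩
    (fun y hy => by
      rw [List.mem_ofFn] at hy
      obtain ⟨i, rfl⟩ := hy
      exact hH' _) (hH' 0) hroot'

/-- Empty exception list: NO algebraic number of degree `d` and height `≤ H` lies in `[a, b]`. -/
theorem not_mem_algFamily_of_algExcluded {d H : ℕ} {a b : ℚ} {depth fuel : ℕ}
    (h : algExcluded d H a b depth fuel [] = true) {x : ℝ} (hx : (a : ℝ) ≤ x ∧ x ≤ b) :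
    x ∉ algFamily d H := fun hmem => by
  obtain ⟨q, hq, _⟩ := algExcluded_sound h hx hmem
  simp at hq

/-! ### Bridges from the floor's statements -/

/-- **ALG sentence for `Δ_σ`.** Under `IsingEnclosure W R` with the `Δ_σ`-projection of `R` inside
`[a, b]` and `algExcluded d H a b depth fuel ex = true`: if the `Δ_σ` of an admissible datum in the
window is algebraic of degree `d` and height `≤ H`, it is a root of a listed polynomial. -/
theorem sigma_alg_covered_of_isingEnclosure {W R : Set (ℝ × ℝ)} (h : IsingEnclosure W R) {a b : ℚ}
    (hR : ∀ q ∈ R, (a : ℝ) ≤ q.1 ∧ q.1 ≤ b) {d H depth fuel : ℕ} {ex : List (List ℤ)}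
    (hx : algExcluded d H a b depth fuel ex = true) (D : SigmaEpsilonData)
    (hD : D.SatisfiesBootstrapAxioms) (hW : (D.Δσ, D.Δε) ∈ W) (hmem : D.Δσ ∈ algFamily d H) :
    ∃ q ∈ ex, evalL q D.Δσ = 0 :=
  algExcluded_sound hx (hR _ (h D hD hW)) hmem

/-- Contrapositive form: if no listed polynomial vanishes at `Δ_σ`, then `Δ_σ ∉ algFamily d H`. -/
theorem sigma_not_alg_of_isingEnclosure {W R : Set (ℝ × ℝ)} (h : IsingEnclosure W R) {a b : ℚ}
    (hR : ∀ q ∈ R, (a : ℝ) ≤ q.1 ∧ q.1 ≤ b) {d H depth fuel : ℕ} {ex : List (List ℤ)}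
    (hx : algExcluded d H a b depth fuel ex = true) (D : SigmaEpsilonData)
    (hD : D.SatisfiesBootstrapAxioms) (hW : (D.Δσ, D.Δε) ∈ W) (hex : ∀ q ∈ ex, evalL q D.Δσ ≠ 0) :
    D.Δσ ∉ algFamily d H := fun hmem => by
  obtain ⟨q, hq, h0⟩ := sigma_alg_covered_of_isingEnclosure h hR hx D hD hW hmem
  exact hex q hq h0

/-- **ALG sentence for `Δ_ε`.** -/
theorem eps_alg_covered_of_isingEnclosure {W R : Set (ℝ × ℝ)} (h : IsingEnclosure W R) {a b : ℚ}
    (hR : ∀ q ∈ R, (a : ℝ) ≤ q.2 ∧ q.2 ≤ b) {d H depth fuel : ℕ} {ex : List (List ℤ)}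
    (hx : algExcluded d H a b depth fuel ex = true) (D : SigmaEpsilonData)
    (hD : D.SatisfiesBootstrapAxioms) (hW : (D.Δσ, D.Δε) ∈ W) (hmem : D.Δε ∈ algFamily d H) :
    ∃ q ∈ ex, evalL q D.Δε = 0 :=
  algExcluded_sound hx (hR _ (h D hD hW)) hmem

/-- Contrapositive form for `Δ_ε`. -/
theorem eps_not_alg_of_isingEnclosure {W R : Set (ℝ × ℝ)} (h : IsingEnclosure W R) {a b : ℚ}
    (hR : ∀ q ∈ R, (a : ℝ) ≤ q.2 ∧ q.2 ≤ b) {d H depth fuel : ℕ} {ex : List (List ℤ)}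
    (hx : algExcluded d H a b depth fuel ex = true) (D : SigmaEpsilonData)
    (hD : D.SatisfiesBootstrapAxioms) (hW : (D.Δσ, D.Δε) ∈ W) (hex : ∀ q ∈ ex, evalL q D.Δε ≠ 0) :
    D.Δε ∉ algFamily d H := fun hmem => by
  obtain ⟨q, hq, h0⟩ := eps_alg_covered_of_isingEnclosure h hR hx D hD hW hmem
  exact hex q hq h0

end Summit.CriticalPhenomena.Ising3D
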